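import Literature.Analysis.Complex.HorizontalStripResidues
import Mathlib.Analysis.SpecialFunctions.Gaussian.GaussianIntegral
import Mathlib.Analysis.Fourier.FourierTransform
import HarnessLib

/-!
# Exponential decay of the Fourier transform of a Gaussian-damped function holomorphic in a strip

Analysis/Complex support file (everything proved; no definitions, no named facts). The
Paley–Wiener mechanism for horizontal strips: if `g` is holomorphic in the open strip
`{|Im z| < a}` and of at most exponential growth `‖g(x + iy)‖ ≤ M e^{κ|x|}` on the closed sub-strip
`{|Im z| ≤ c}`, `0 ≤ c < a`, then the Fourier transform of the Gaussian-damped restriction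
`x ↦ g(x) e^{-b x²}` (`b > 0`) decays like `e^{-2πc|ξ|}`:

  `‖𝓕 (g · e^{-b ·²}) (ξ)‖ ≤ M e^{b c²} (∫ e^{κ|x| - b x²} dx) e^{-2π c |ξ|}`

(`norm_fourier_mul_gaussian_le_of_strip`). Proof: shift the line of integration to `Im z = ∓c`
(the tree's residue theorem for a horizontal strip with no poles,
`Literature.Analysis.Complex.integral_horizontal_sub_eq_sum_of_simplePoles`; the Gaussian factor
makes the integrand integrable on every horizontal line and uniformly small on the far vertical
cross-sections), where the character `e^{-2πiξz}` has modulus `e^{-2πc|ξ|}`. The Gaussian damping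
is what allows exponential growth of `g` along the strip; this is the form in which the estimate
serves the Fourier-transform proof of the Malgrange–Zerner ("flat tube") theorem
(`Literature/Analysis/Complex/FlatTubeFourier.lean`), where `g(s) = ⟨v, e^{-e^{s} H} w⟩ e^{s}` is a
matrix element of a holomorphic contraction semigroup in the logarithm of the time variable.

Classical statement without damping: Stein–Shakarchi, *Complex Analysis*, Ch. 4, Thm. 3.1 (the class
`𝔉_a`: holomorphic in `|Im z| < a` with `|f(x+iy)| ≤ A/(1+x²)` ⇒ `|f̂(ξ)| ≤ B e^{-2πb|ξ|}`, `b < a`);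
Paley–Wiener (1934). Everything here is tagged folklore.

## Mathlib / tree

Used: `Real.fourier_real_eq_integral_exp_smul` (`𝓕 f ξ = ∫ e^{-2πi x ξ} f(x) dx`),
`integrable_exp_neg_mul_sq`, `Filter.Tendsto.atTop_mul_atBot₀`, `Real.tendsto_exp_atBot`; from the
tree `integral_horizontal_sub_eq_sum_of_simplePoles` (`HorizontalStripResidues`).
-/

noncomputable section

open _root_.Complex Set MeasureTheory Filter Real
open scoped _root_.Topology FourierTransform

namespace Literature.Analysis.Complex

/-! ### The weight `e^{κ|x| - b x²}` -/

/-- `κ|x| - b x² ≤ κ²/(2b) - (b/2) x²` (`b > 0`): completing the square. [folklore] -/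
theorem mul_abs_sub_mul_sq_le {b : ℝ} (hb : 0 < b) (κ x : ℝ) :
    κ * |x| - b * x ^ 2 ≤ κ ^ 2 / (2 * b) - b / 2 * x ^ 2 := by
  have h : 0 ≤ b / 2 * (|x| - κ / b) ^ 2 := by positivity
  have hx : |x| ^ 2 = x ^ 2 := sq_abs x
  have hexp : b / 2 * (|x| - κ / b) ^ 2 = b / 2 * x ^ 2 - κ * |x| + κ ^ 2 / (2 * b) := by
    field_simp
    rw [← hx]
    ring
  linarith [hexp ▸ h]

/-- The weight `x ↦ e^{κ|x| - b x²}` is integrable on `ℝ` for `b > 0`. [folklore] -/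
theorem integrable_exp_mul_abs_sub_mul_sq {b : ℝ} (hb : 0 < b) (κ : ℝ) :
    Integrable fun x : ℝ => Real.exp (κ * |x| - b * x ^ 2) := by
  have hint : Integrable fun x : ℝ => Real.exp (κ ^ 2 / (2 * b)) * Real.exp (-(b / 2) * x ^ 2) :=
    (integrable_exp_neg_mul_sq (by positivity)).const_mul _
  refine hint.mono' (by fun_prop) (Eventually.of_forall fun x => ?_)
  rw [Real.norm_eq_abs, abs_of_pos (Real.exp_pos _), ← Real.exp_add]
  exact Real.exp_le_exp.2 (by linarith [mul_abs_sub_mul_sq_le hb κ x])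

/-- The weight integral `∫ e^{κ|x| - b x²} dx` is positive. [folklore] -/
theorem integral_exp_mul_abs_sub_mul_sq_pos {b : ℝ} (hb : 0 < b) (κ : ℝ) :
    0 < ∫ x : ℝ, Real.exp (κ * |x| - b * x ^ 2) :=
  integral_exp_pos (integrable_exp_mul_abs_sub_mul_sq hb κ)

/-- `C e^{κ T - b T²} → 0` as `T → +∞` (`b > 0`). [folklore] -/
theorem tendsto_const_mul_exp_mul_sub_mul_sq {b : ℝ} (hb : 0 < b) (κ C : ℝ) :
    Tendsto (fun T : ℝ => C * Real.exp (κ * T - b * T ^ 2)) atTop (𝓝 0) := by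
  have h1 : Tendsto (fun T : ℝ => κ - b * T) atTop atBot :=
    tendsto_atBot_add_const_left _ κ
      (tendsto_neg_atTop_atBot.comp (Tendsto.const_mul_atTop hb tendsto_id) |>.congr fun T => by
        simp)
  have h2 : Tendsto (fun T : ℝ => T * (κ - b * T)) atTop atBot := tendsto_id.atTop_mul_atBot₀ h1
  have h3 : Tendsto (fun T : ℝ => Real.exp (T * (κ - b * T))) atTop (𝓝 0) :=
    Real.tendsto_exp_atBot.comp h2
  have h4 := h3.const_mul C
  rw [mul_zero] at h4
  refine h4.congr fun T => ?_
  congr 2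
  ring

/-! ### The strip, the integrand and its size on horizontal lines -/

variable {g : ℂ → ℂ} {a b c M κ : ℝ}

/-- The integrand of the shifted Fourier integral, `h(z) = e^{-2πi ξ z} g(z) e^{-b z²}`, at a real
point is the Fourier integrand of `x ↦ g(x) e^{-bx²}`. [folklore] -/
theorem fourierStripIntegrand_ofReal (g : ℂ → ℂ) (b ξ x : ℝ) :
    Complex.exp (-(2 * π * ξ : ℝ) * I * (x : ℂ)) * (g x * Complex.exp (-(b : ℂ) * (x : ℂ) ^ 2)) =
      Complex.exp (↑(-2 * π * x * ξ) * I) • (g x * Complex.exp (-(b : ℂ) * (x : ℂ) ^ 2)) := by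
  rw [smul_eq_mul]
  congr 2
  push_cast
  ring

/-- The modulus of the integrand on the line `Im z = y`:
`‖h(x + iy)‖ = e^{2πξy} ‖g(x+iy)‖ e^{-b(x² - y²)}`. [folklore] -/
theorem norm_fourierStripIntegrand (g : ℂ → ℂ) (b ξ x y : ℝ) :
    ‖Complex.exp (-(2 * π * ξ : ℝ) * I * (x + y * I)) *
        (g (x + y * I) * Complex.exp (-(b : ℂ) * ((x : ℂ) + y * I) ^ 2))‖ =
      Real.exp (2 * π * ξ * y) * (‖g (x + y * I)‖ * Real.exp (-b * (x ^ 2 - y ^ 2))) := by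
  rw [norm_mul, norm_mul, Complex.norm_exp, Complex.norm_exp]
  have h1 : (-((2 * π * ξ : ℝ) : ℂ) * I * (x + y * I)).re = 2 * π * ξ * y := by
    simp only [neg_mul, mul_re, mul_im, neg_re, ofReal_re, ofReal_im, I_re, I_im, add_re,
      add_im, mul_zero, mul_one, zero_mul, add_zero, sub_zero, zero_add, zero_sub, neg_neg]
  have h2 : (-(b : ℂ) * ((x : ℂ) + y * I) ^ 2).re = -b * (x ^ 2 - y ^ 2) := by
    simp only [sq, neg_mul, mul_re, mul_im, neg_re, ofReal_re, ofReal_im, I_re, I_im, add_re,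
      add_im, mul_zero, mul_one, zero_mul, add_zero, sub_zero, zero_add]
  rw [h1, h2]

/-- On the closed sub-strip `|y| ≤ c` the integrand is dominated by a fixed Gaussian weight:
`‖h(x + iy)‖ ≤ e^{2π|ξ|c} M e^{bc²} e^{κ|x| - bx²}`. [folklore] -/
theorem norm_fourierStripIntegrand_le (hb : 0 < b)
    (hM : ∀ z : ℂ, |z.im| ≤ c → ‖g z‖ ≤ M * Real.exp (κ * |z.re|)) (ξ x : ℝ) {y : ℝ} (hy : |y| ≤ c) :
    ‖Complex.exp (-(2 * π * ξ : ℝ) * I * (x + y * I)) *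
        (g (x + y * I) * Complex.exp (-(b : ℂ) * ((x : ℂ) + y * I) ^ 2))‖ ≤
      Real.exp (2 * π * |ξ| * c) * (M * Real.exp (b * c ^ 2)) * Real.exp (κ * |x| - b * x ^ 2) := by
  rw [norm_fourierStripIntegrand]
  have h1 : Real.exp (2 * π * ξ * y) ≤ Real.exp (2 * π * |ξ| * c) := by
    refine Real.exp_le_exp.2 ?_
    have hξy : ξ * y ≤ |ξ| * c :=
      (le_abs_self _).trans (by rw [abs_mul]; gcongr)
    nlinarith [Real.pi_pos]
  have h2 : ‖g (x + y * I)‖ ≤ M * Real.exp (κ * |x|) := by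
    simpa using hM (x + y * I) (by simpa using hy)
  have h3 : Real.exp (-b * (x ^ 2 - y ^ 2)) ≤ Real.exp (b * c ^ 2) * Real.exp (-b * x ^ 2) := by
    rw [← Real.exp_add]
    refine Real.exp_le_exp.2 ?_
    have : y ^ 2 ≤ c ^ 2 := by
      rw [← sq_abs y]
      exact pow_le_pow_left₀ (abs_nonneg y) hy 2
    nlinarith
  have hG0 : 0 ≤ M * Real.exp (κ * |x|) := (norm_nonneg _).trans h2
  calc Real.exp (2 * π * ξ * y) * (‖g (x + y * I)‖ * Real.exp (-b * (x ^ 2 - y ^ 2)))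
      ≤ Real.exp (2 * π * |ξ| * c) *
          (M * Real.exp (κ * |x|) * (Real.exp (b * c ^ 2) * Real.exp (-b * x ^ 2))) :=
        mul_le_mul h1 (mul_le_mul h2 h3 (by positivity) hG0) (by positivity) (by positivity)
    _ = Real.exp (2 * π * |ξ| * c) * (M * Real.exp (b * c ^ 2)) *
          Real.exp (κ * |x| - b * x ^ 2) := by
        rw [sub_eq_add_neg, Real.exp_add (κ * |x|)]
        ring

/-- The integrand is continuous along every horizontal line inside the open strip. [folklore] -/
theorem continuous_fourierStripIntegrand_line (hg : DifferentiableOn ℂ g {z : ℂ | |z.im| < a})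
    (ξ : ℝ) {y : ℝ} (hy : |y| < a) :
    Continuous fun x : ℝ => Complex.exp (-(2 * π * ξ : ℝ) * I * (x + y * I)) *
      (g (x + y * I) * Complex.exp (-(b : ℂ) * ((x : ℂ) + y * I) ^ 2)) := by
  have hline : Continuous fun x : ℝ => (x : ℂ) + y * I := by fun_prop
  have hmem : ∀ x : ℝ, (x : ℂ) + y * I ∈ {z : ℂ | |z.im| < a} := fun x => by simpa using hy
  have hgc : Continuous fun x : ℝ => g (x + y * I) :=
    hg.continuousOn.comp_continuous hline hmem
  exact ((Complex.continuous_exp.comp (by fun_prop)).mul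
    (hgc.mul (Complex.continuous_exp.comp (by fun_prop))))

/-- The integrand is integrable along every horizontal line of the closed sub-strip. [folklore] -/
theorem integrable_fourierStripIntegrand_line (hg : DifferentiableOn ℂ g {z : ℂ | |z.im| < a})
    (hca : c < a) (hb : 0 < b)
    (hM : ∀ z : ℂ, |z.im| ≤ c → ‖g z‖ ≤ M * Real.exp (κ * |z.re|)) (ξ : ℝ) {y : ℝ} (hy : |y| ≤ c) :
    Integrable fun x : ℝ => Complex.exp (-(2 * π * ξ : ℝ) * I * (x + y * I)) *
      (g (x + y * I) * Complex.exp (-(b : ℂ) * ((x : ℂ) + y * I) ^ 2)) := by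
  refine ((integrable_exp_mul_abs_sub_mul_sq hb κ).const_mul
    (Real.exp (2 * π * |ξ| * c) * (M * Real.exp (b * c ^ 2)))).mono'
    (continuous_fourierStripIntegrand_line hg ξ (hy.trans_lt hca)).aestronglyMeasurable
    (Eventually.of_forall fun x => norm_fourierStripIntegrand_le hb hM ξ x hy)

/-! ### The contour shift -/

/-- **Shifting the Fourier integral to the line `Im z = y`** (`|y| ≤ c < a`): for `g` holomorphic in
the open strip `{|Im z| < a}` with `‖g(x+iy')‖ ≤ M e^{κ|x|}` on `{|Im z| ≤ c}`,
`∫ e^{-2πiξx} g(x) e^{-bx²} dx = ∫ e^{-2πiξ(x+iy)} g(x+iy) e^{-b(x+iy)²} dx` (Cauchy's theorem on long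
rectangles; the Gaussian kills the vertical sides). [folklore] -/
theorem integral_fourier_integrand_eq_integral_line (hg : DifferentiableOn ℂ g {z : ℂ | |z.im| < a})
    (hca : c < a) (hb : 0 < b)
    (hM : ∀ z : ℂ, |z.im| ≤ c → ‖g z‖ ≤ M * Real.exp (κ * |z.re|)) (ξ : ℝ) {y : ℝ} (hy : |y| ≤ c) :
    ∫ x : ℝ, Complex.exp (↑(-2 * π * x * ξ) * I) • (g x * Complex.exp (-(b : ℂ) * (x : ℂ) ^ 2)) =
      ∫ x : ℝ, Complex.exp (-(2 * π * ξ : ℝ) * I * (x + y * I)) *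
        (g (x + y * I) * Complex.exp (-(b : ℂ) * ((x : ℂ) + y * I) ^ 2)) := by
  -- both sides are line integrals of `h(z) = e^{-2πiξz} g(z) e^{-bz²}`
  set h : ℂ → ℂ := fun z => Complex.exp (-(2 * π * ξ : ℝ) * I * z) *
    (g z * Complex.exp (-(b : ℂ) * z ^ 2)) with hh
  have hL : (fun x : ℝ => Complex.exp (↑(-2 * π * x * ξ) * I) •
      (g x * Complex.exp (-(b : ℂ) * (x : ℂ) ^ 2))) = fun x : ℝ => h (x + (0 : ℝ) * I) := by
    funext x
    rw [hh, ← fourierStripIntegrand_ofReal]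
    simp
  change _ = ∫ x : ℝ, h (x + y * I)
  rw [hL]
  rcases eq_or_ne y 0 with rfl | hy0
  · rfl
  -- the strip between the lines `Im z = min y 0` and `Im z = max y 0`
  have hc0 : 0 < c := lt_of_lt_of_le (abs_pos.2 hy0) hy
  have key : ∀ {y₁ y₂ : ℝ}, y₁ < y₂ → |y₁| ≤ c → |y₂| ≤ c →
      (∫ x : ℝ, h (x + y₁ * I)) = ∫ x : ℝ, h (x + y₂ * I) := by
    intro y₁ y₂ h12 h1 h2
    have hU : IsOpen {z : ℂ | |z.im| < a} :=
      isOpen_lt (continuous_abs.comp Complex.continuous_im) continuous_const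
    have hsub : Complex.im ⁻¹' Icc y₁ y₂ ⊆ {z : ℂ | |z.im| < a} := by
      intro z hz
      simp only [mem_preimage, mem_Icc] at hz
      show |z.im| < a
      rw [abs_lt]
      constructor
      · have := (abs_le.1 h1).1; linarith
      · have := (abs_le.1 h2).2; linarith
    have hdiff : DifferentiableOn ℂ h ({z : ℂ | |z.im| < a} \ ((∅ : Finset ℂ) : Set ℂ)) := by
      rw [Finset.coe_empty, Set.sdiff_empty]
      have hL : Differentiable ℂ fun z : ℂ => Complex.exp (-((2 * π * ξ : ℝ) : ℂ) * I * z) :=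
        Complex.differentiable_exp.comp ((differentiable_const _).mul differentiable_id)
      have hQ : Differentiable ℂ fun z : ℂ => Complex.exp (-(b : ℂ) * z ^ 2) :=
        Complex.differentiable_exp.comp ((differentiable_const _).mul (differentiable_id.pow 2))
      rw [hh]
      exact hL.differentiableOn.mul (hg.mul hQ.differentiableOn)
    have hdecay : ∀ ε : ℝ, 0 < ε → ∃ T₀ : ℝ, ∀ T : ℝ, T₀ ≤ |T| → ∀ y' ∈ Icc y₁ y₂,
        ‖h (T + y' * I)‖ ≤ ε := by
      intro ε hε
      have ht := tendsto_const_mul_exp_mul_sub_mul_sq hb κ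
        (Real.exp (2 * π * |ξ| * c) * (M * Real.exp (b * c ^ 2)))
      obtain ⟨T₀, hT₀⟩ := eventually_atTop.1 (ht.eventually (gt_mem_nhds hε))
      refine ⟨T₀, fun T hT y' hy' => ?_⟩
      have hy'c : |y'| ≤ c := abs_le.2 ⟨by have := (abs_le.1 h1).1; exact le_trans (by linarith) hy'.1,
        hy'.2.trans (le_abs_self y₂ |>.trans h2)⟩
      refine (norm_fourierStripIntegrand_le hb hM ξ T hy'c).trans ?_
      have h := (hT₀ |T| hT).le
      simpa [sq_abs] using h
    have hres := integral_horizontal_sub_eq_sum_of_simplePoles h12 ∅ (fun _ => 0)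
      {z : ℂ | |z.im| < a} hU hsub (by simp) hdiff (by simp)
      (integrable_fourierStripIntegrand_line hg hca hb hM ξ h1)
      (integrable_fourierStripIntegrand_line hg hca hb hM ξ h2) hdecay
    simp only [Finset.sum_empty, mul_zero] at hres
    exact sub_eq_zero.1 hres
  rcases lt_or_gt_of_ne hy0 with hneg | hpos
  · exact (key hneg hy (by simpa using hc0.le)).symm
  · exact key hpos (by simpa using hc0.le) hy

/-! ### The decay estimate -/

/-- **Exponential decay of the Fourier transform of a Gaussian-damped function holomorphic in a
strip** (Paley–Wiener mechanism; cf. Stein–Shakarchi, *Complex Analysis*, Ch. 4 Thm. 3.1): if `g`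
is holomorphic in `{|Im z| < a}` and `‖g(x + iy)‖ ≤ M e^{κ|x|}` for `|y| ≤ c`, `0 ≤ c < a`, then for
`b > 0` and every `ξ`,
`‖𝓕 (x ↦ g(x) e^{-bx²}) (ξ)‖ ≤ M e^{bc²} (∫ e^{κ|x| - bx²} dx) e^{-2πc|ξ|}`. Proof: shift the
contour to `Im z = -c · sgn ξ` (`integral_fourier_integrand_eq_integral_line`), where `|e^{-2πiξz}| = e^{-2πc|ξ|}`,
`|e^{-bz²}| = e^{-b(x²-c²)}`. [folklore] -/
theorem norm_fourier_mul_gaussian_le_of_strip (hg : DifferentiableOn ℂ g {z : ℂ | |z.im| < a})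
    (hc : 0 ≤ c) (hca : c < a) (hb : 0 < b)
    (hM : ∀ z : ℂ, |z.im| ≤ c → ‖g z‖ ≤ M * Real.exp (κ * |z.re|)) (ξ : ℝ) :
    ‖𝓕 (fun x : ℝ => g x * Complex.exp (-(b : ℂ) * (x : ℂ) ^ 2)) ξ‖ ≤
      M * Real.exp (b * c ^ 2) * (∫ x : ℝ, Real.exp (κ * |x| - b * x ^ 2)) *
        Real.exp (-(2 * π * c * |ξ|)) := by
  -- the height to shift to: `y = -c` for `ξ ≥ 0`, `y = c` for `ξ < 0`, so that `ξ y = -c|ξ|`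
  set y : ℝ := if 0 ≤ ξ then -c else c with hy_def
  have hyc : |y| ≤ c := by
    rw [hy_def]; split_ifs <;> simp [abs_of_nonneg hc]
  have hξy : ξ * y = -(c * |ξ|) := by
    rw [hy_def]; split_ifs with h
    · rw [abs_of_nonneg h]; ring
    · rw [abs_of_neg (not_le.1 h)]; ring
  rw [Real.fourier_real_eq_integral_exp_smul, integral_fourier_integrand_eq_integral_line hg hca hb hM ξ hyc]
  refine (norm_integral_le_integral_norm _).trans ?_
  have hpt : ∀ x : ℝ, ‖Complex.exp (-(2 * π * ξ : ℝ) * I * (x + y * I)) *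
      (g (x + y * I) * Complex.exp (-(b : ℂ) * ((x : ℂ) + y * I) ^ 2))‖ ≤
      M * Real.exp (b * c ^ 2) * Real.exp (-(2 * π * c * |ξ|)) * Real.exp (κ * |x| - b * x ^ 2) := by
    intro x
    rw [norm_fourierStripIntegrand]
    have h2 : ‖g (x + y * I)‖ ≤ M * Real.exp (κ * |x|) := by
      simpa using hM (x + y * I) (by simpa using hyc)
    have h3 : Real.exp (-b * (x ^ 2 - y ^ 2)) ≤ Real.exp (b * c ^ 2) * Real.exp (-b * x ^ 2) := by
      rw [← Real.exp_add]
      refine Real.exp_le_exp.2 ?_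
      have : y ^ 2 ≤ c ^ 2 := by
        rw [← sq_abs y]
        exact pow_le_pow_left₀ (abs_nonneg y) hyc 2
      nlinarith
    have hM0 : 0 ≤ M * Real.exp (κ * |x|) := (norm_nonneg _).trans h2
    calc Real.exp (2 * π * ξ * y) * (‖g (x + y * I)‖ * Real.exp (-b * (x ^ 2 - y ^ 2)))
        ≤ Real.exp (2 * π * ξ * y) *
            (M * Real.exp (κ * |x|) * (Real.exp (b * c ^ 2) * Real.exp (-b * x ^ 2))) := by
          gcongr
      _ = M * Real.exp (b * c ^ 2) * Real.exp (-(2 * π * c * |ξ|)) *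
            Real.exp (κ * |x| - b * x ^ 2) := by
          rw [sub_eq_add_neg (κ * |x|), Real.exp_add (κ * |x|),
            show 2 * π * ξ * y = -(2 * π * c * |ξ|) by rw [mul_assoc (2 * π), hξy]; ring]
          ring
  calc ∫ x : ℝ, ‖Complex.exp (-(2 * π * ξ : ℝ) * I * (x + y * I)) *
        (g (x + y * I) * Complex.exp (-(b : ℂ) * ((x : ℂ) + y * I) ^ 2))‖
      ≤ ∫ x : ℝ, M * Real.exp (b * c ^ 2) * Real.exp (-(2 * π * c * |ξ|)) *
          Real.exp (κ * |x| - b * x ^ 2) :=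
        integral_mono_of_nonneg (Eventually.of_forall fun x => norm_nonneg _)
          ((integrable_exp_mul_abs_sub_mul_sq hb κ).const_mul _) (Eventually.of_forall hpt)
    _ = M * Real.exp (b * c ^ 2) * (∫ x : ℝ, Real.exp (κ * |x| - b * x ^ 2)) *
          Real.exp (-(2 * π * c * |ξ|)) := by
        rw [integral_const_mul]
        ring

end Literature.Analysis.Complex
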